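import Literature.MathematicalPhysics.QuantumFieldTheory.Balaban1983to89.B9Eq386Neumann

/-!
# `Balaban1983to89.B9Eq3130Neumann` (+ v1.1: the twin (3.138) p. 423 for `G₁`) — [Balaban1985BackgroundPropagators] p. 421, display (3.130): the Sect.-D propagator
# `G = G₀(I − Δ′_πG₀)⁻¹ = Σ_{n≥0} G₀(Δ′_πG₀)ⁿ` AS PRINTED, in a normed ring with summable geometric series — the B9-side
# instance, with print's letters, of the generic Neumann/resolvent identities of `B9Eq386Neumann` (print itself: «Similarly as in
# (3.130) we get … (3.138)», and (3.86) is the same display for `G(U′U)`); seat r06 (B9 fold owner) gen 24, row B9.Eq3.130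

statement-level skeleton of published theorems with citation tags; proofs where landed; nothing here is a claim about the Yang–Mills mass gap

CITATION HEADER (lean-in-tree rule).  T. Bałaban, *Propagators for lattice gauge theories in a background field*, Commun. Math. Phys. **99**
(1985) 389–434 [Balaban1985BackgroundPropagators] (held `paper:balaban1985-cmp99-background-propagators`, journal page = PDF page + 388; render
`b2b-balaban-ref1/pages/1985-cmp99-background-propagators/…-p033-x2.png` re-read as an image by this seat 2026-08-23).  p. 421 [PDF 33]: «Now we
will prove that Theorems 3.3, 3.10, 3.11 hold for the propagators G, G₁. This will be an immediate consequence of perturbative expansions we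
will construct. Let us denote for a moment the operator we have investigated in previous sections by G₀, i.e. G₀ = (Δ + DRD* + Q*aQ)⁻¹. From
(3.120) we get G = G₀(I − Δ′_πG₀)⁻¹ = Σ_{n=0}^∞ G₀(Δ′_πG₀)ⁿ. (3.130)»; (3.120) p. 419 (Δ_π = Δ − Δ′_π, the definition of Δ′_π) and (3.122)
p. 420 «G⁻¹ defined as G⁻¹ = Δ_π + DRD* + Q*aQ».

WHAT IS PROVED (theorems only; 0 `def`, 0 named fact, 0 sorry; standard axioms).  Letters, as printed: `Δ`, `DRDs = DRD*`, `QsaQ = Q*aQ`,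
`Δπ' = Δ′_π` in a normed ring `R` with summable geometric series (e.g. complete: the finite lattice operators), `G₀` a two-sided inverse of
`Δ + DRD* + Q*aQ`, and the convergence hypothesis `‖Δ′_πG₀‖ < 1` (print: «for α₀ sufficiently small», the smallness being (3.131)).
* `Ginv_eq` — «From (3.120)»: `G⁻¹ = Δ_π + DRD* + Q*aQ = (Δ + DRD* + Q*aQ) − Δ′_π` for `Δ_π = Δ − Δ′_π` (ring algebra).
* **`eq3130_inverse_form`** — `(Δ + DRD* + Q*aQ − Δ′_π)⁻¹ = G₀(1 − Δ′_πG₀)⁻¹` (`Ring.inverse`; `B9Eq386Neumann.inverse_sub_eq_gNew` +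
  `gNew_eq_mul_inverse`).
* **`eq3130_series`** — `(… − Δ′_π)⁻¹ = Σ'_{n} G₀(Δ′_πG₀)ⁿ` (`tsum`) and **`eq3130_hasSum`** — the series CONVERGES (in norm) to it.
* `eq3130_twoSided` — the sum `G` IS the propagator: `(G⁻¹)G = 1 = G(G⁻¹)` for `G⁻¹ = Δ + DRD* + Q*aQ − Δ′_π`.
* `eq3130_fixedPoint` — the resolvent form `G = G₀ + G₀Δ′_πG` in which the Sect.-D bookkeeping consumes (3.130)
  (`B9SectDL2Decay.resolvent_fix`/`rightEntry_fix`, `B9SectDSup.factored_rightEntry_fix`).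
HONEST SCOPE.  Pure normed-ring algebra/analysis at the generality of `B9Eq386Neumann` (whose (3.86) theorems this file instantiates with the
(3.130) letters); the smallness `‖Δ′_πG₀‖ < 1` and the entry-wise convergence «in all norms appearing on the left-hand sides of (3.42)–(3.47)»
(Theorem 3.12) are rows B9.Eq3.130 ((3.131)) / B9.Thm3.12 and are NOT treated here.  NOT summit progress.
-/

noncomputable section

namespace Literature.MathematicalPhysics.QuantumFieldTheory.Balaban1983to89.B9Eq3130Neumann

open Literature.MathematicalPhysics.QuantumFieldTheory.Balaban1983to89.B9Eq386Neumann
open scoped Topology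

section Algebra

variable {R : Type*} [Ring R]

/-- **«From (3.120) we get»**: with `Δ_π := Δ − Δ′_π` ((3.120)), the inverse propagator `G⁻¹ = Δ_π + DRD* + Q*aQ` ((3.122)) is
`(Δ + DRD* + Q*aQ) − Δ′_π = G₀⁻¹ − Δ′_π`. [cite: Balaban1985BackgroundPropagators, (3.120) p.419, (3.122) p.420, (3.130) p.421] -/
theorem Ginv_eq (Δ Δπ' DRDs QsaQ : R) : (Δ - Δπ') + DRDs + QsaQ = (Δ + DRDs + QsaQ) - Δπ' := by abel

end Algebra

section Neumann

variable {R : Type*} [NormedRing R] [HasSummableGeomSeries R]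

/-- **(3.130), first equality**: `G = (G₀⁻¹ − Δ′_π)⁻¹ = G₀(I − Δ′_πG₀)⁻¹` for `G₀ = (Δ + DRD* + Q*aQ)⁻¹` two-sided and `‖Δ′_πG₀‖ < 1`
(`Ring.inverse` on both sides; the inner inverse exists as the unit `1 − Δ′_πG₀`).
[cite: Balaban1985BackgroundPropagators, (3.130) p.421] -/
theorem eq3130_inverse_form (Δ DRDs QsaQ Δπ' G₀ : R) (h₁ : (Δ + DRDs + QsaQ) * G₀ = 1) (h₂ : G₀ * (Δ + DRDs + QsaQ) = 1)
    (h : ‖Δπ' * G₀‖ < 1) :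
    Ring.inverse ((Δ + DRDs + QsaQ) - Δπ') = G₀ * Ring.inverse (1 - Δπ' * G₀) := by
  rw [inverse_sub_eq_gNew _ Δπ' G₀ h₁ h₂ h, gNew_eq_mul_inverse _ _ h]

/-- **(3.130), second equality**: `G = Σ_{n=0}^∞ G₀(Δ′_πG₀)ⁿ` (Mathlib `tsum`).
[cite: Balaban1985BackgroundPropagators, (3.130) p.421] -/
theorem eq3130_series (Δ DRDs QsaQ Δπ' G₀ : R) (h₁ : (Δ + DRDs + QsaQ) * G₀ = 1) (h₂ : G₀ * (Δ + DRDs + QsaQ) = 1)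
    (h : ‖Δπ' * G₀‖ < 1) :
    Ring.inverse ((Δ + DRDs + QsaQ) - Δπ') = ∑' n : ℕ, G₀ * (Δπ' * G₀) ^ n := by
  rw [inverse_sub_eq_gNew _ Δπ' G₀ h₁ h₂ h, gNew_eq_tsum _ _ h]

/-- **The series (3.130) converges** (in the norm of `R`) to the propagator `G`.
[cite: Balaban1985BackgroundPropagators, (3.130) p.421, p.422 («a convergence of the series (3.130), for α₀ sufficiently small»)] -/
theorem eq3130_hasSum (Δ DRDs QsaQ Δπ' G₀ : R) (h₁ : (Δ + DRDs + QsaQ) * G₀ = 1) (h₂ : G₀ * (Δ + DRDs + QsaQ) = 1)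
    (h : ‖Δπ' * G₀‖ < 1) :
    HasSum (fun n : ℕ => G₀ * (Δπ' * G₀) ^ n) (Ring.inverse ((Δ + DRDs + QsaQ) - Δπ')) := by
  rw [inverse_sub_eq_gNew _ Δπ' G₀ h₁ h₂ h]
  exact hasSum_gNew _ _ h

/-- **`G` IS the propagator of (3.122)**: the sum `G = G₀Σ(Δ′_πG₀)ⁿ` is a two-sided inverse of `G⁻¹ = Δ + DRD* + Q*aQ − Δ′_π`.
[cite: Balaban1985BackgroundPropagators, (3.122) p.420, (3.130) p.421] -/
theorem eq3130_twoSided (Δ DRDs QsaQ Δπ' G₀ : R) (h₁ : (Δ + DRDs + QsaQ) * G₀ = 1) (h₂ : G₀ * (Δ + DRDs + QsaQ) = 1)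
    (h : ‖Δπ' * G₀‖ < 1) :
    ((Δ + DRDs + QsaQ) - Δπ') * gNew G₀ Δπ' = 1 ∧ gNew G₀ Δπ' * ((Δ + DRDs + QsaQ) - Δπ') = 1 :=
  ⟨sub_mul_gNew _ Δπ' G₀ h₁ h, gNew_mul_sub _ Δπ' G₀ h₂ h⟩

/-- **The resolvent (fixed-point) form of (3.130)**: `G = G₀ + G₀Δ′_πG` — the shape in which the Sect.-D bookkeeping uses (3.130)
(`B9SectDL2Decay.resolvent_fix`). [cite: Balaban1985BackgroundPropagators, (3.130) p.421] -/
theorem eq3130_fixedPoint (Δ DRDs QsaQ Δπ' G₀ : R) (h₁ : (Δ + DRDs + QsaQ) * G₀ = 1) (h₂ : G₀ * (Δ + DRDs + QsaQ) = 1)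
    (h : ‖Δπ' * G₀‖ < 1) :
    gNew G₀ Δπ' = G₀ + G₀ * Δπ' * gNew G₀ Δπ' := by
  have hG := (eq3130_twoSided Δ DRDs QsaQ Δπ' G₀ h₁ h₂ h).1
  -- G₀·[(S₀ − Δ′_π)G] = G₀ ⟹ G − G₀Δ′_πG = G₀
  have h3 : G₀ * (((Δ + DRDs + QsaQ) - Δπ') * gNew G₀ Δπ') = G₀ := by rw [hG, mul_one]
  have h4 : G₀ * (((Δ + DRDs + QsaQ) - Δπ') * gNew G₀ Δπ') = gNew G₀ Δπ' - G₀ * Δπ' * gNew G₀ Δπ' := by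
    rw [sub_mul, mul_sub, ← mul_assoc, ← mul_assoc, h₂, one_mul]
  rw [h4] at h3
  exact (sub_eq_iff_eq_add.mp h3).trans (by rw [add_comm])

end Neumann

/-! ## v1.1 (r06 g24) — (3.138) p. 423: «Similarly as in (3.130) we get G₁ = G₀(I − (Δ′_π + Δ^{(2)}_π)G₀)⁻¹ = Σ_{n=0}^∞ G₀((Δ′_π + Δ^{(2)}_π)G₀)ⁿ»

The propagator `G₁` for `U₁ = U′U` ((3.134)–(3.136) p. 422: `Δ₁ = Δ − Δ′_π − Δ^{(2)}_π` with the second-order fluctuation operator `Δ^{(2)}_π`,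
(3.137) its smallness) — the SAME Neumann device with `Δ′_π` replaced by `Δ′_π + Δ^{(2)}_π`; each statement below is the corresponding
(3.130) statement at that letter (print: «Similarly as in (3.130)»).  The convergence «for α₀ restricted by a small, absolute constant … in all
norms appearing in the formulation of Theorem 3.3» (p. 423) is the displayed hypothesis `‖(Δ′_π + Δ^{(2)}_π)G₀‖ < 1` in the chosen normed ring. -/

section Neumann3138

variable {R : Type*} [NormedRing R] [HasSummableGeomSeries R]

/-- `G₁⁻¹ = Δ − Δ′_π − Δ^{(2)}_π + DRD* + Q*aQ = G₀⁻¹ − (Δ′_π + Δ^{(2)}_π)`. [cite: Balaban1985BackgroundPropagators, (3.136) p.422, (3.138) p.423] -/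
theorem G1inv_eq {R : Type*} [Ring R] (Δ Δπ' Δπ2 DRDs QsaQ : R) :
    (Δ - Δπ' - Δπ2) + DRDs + QsaQ = (Δ + DRDs + QsaQ) - (Δπ' + Δπ2) := by abel

/-- **(3.138), first equality**: `G₁ = G₀(I − (Δ′_π + Δ^{(2)}_π)G₀)⁻¹`. [cite: Balaban1985BackgroundPropagators, (3.138) p.423] -/
theorem eq3138_inverse_form (Δ DRDs QsaQ Δπ' Δπ2 G₀ : R) (h₁ : (Δ + DRDs + QsaQ) * G₀ = 1) (h₂ : G₀ * (Δ + DRDs + QsaQ) = 1)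
    (h : ‖(Δπ' + Δπ2) * G₀‖ < 1) :
    Ring.inverse ((Δ + DRDs + QsaQ) - (Δπ' + Δπ2)) = G₀ * Ring.inverse (1 - (Δπ' + Δπ2) * G₀) :=
  eq3130_inverse_form Δ DRDs QsaQ (Δπ' + Δπ2) G₀ h₁ h₂ h

/-- **(3.138), second equality**: `G₁ = Σ_{n=0}^∞ G₀((Δ′_π + Δ^{(2)}_π)G₀)ⁿ`. [cite: Balaban1985BackgroundPropagators, (3.138) p.423] -/
theorem eq3138_series (Δ DRDs QsaQ Δπ' Δπ2 G₀ : R) (h₁ : (Δ + DRDs + QsaQ) * G₀ = 1) (h₂ : G₀ * (Δ + DRDs + QsaQ) = 1)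
    (h : ‖(Δπ' + Δπ2) * G₀‖ < 1) :
    Ring.inverse ((Δ + DRDs + QsaQ) - (Δπ' + Δπ2)) = ∑' n : ℕ, G₀ * ((Δπ' + Δπ2) * G₀) ^ n :=
  eq3130_series Δ DRDs QsaQ (Δπ' + Δπ2) G₀ h₁ h₂ h

/-- **The series (3.138) converges** to `G₁` («the series (3.138) is convergent for α₀ restricted by a small, absolute constant», p. 423 —
here: under the displayed norm hypothesis). [cite: Balaban1985BackgroundPropagators, (3.138) p.423] -/
theorem eq3138_hasSum (Δ DRDs QsaQ Δπ' Δπ2 G₀ : R) (h₁ : (Δ + DRDs + QsaQ) * G₀ = 1) (h₂ : G₀ * (Δ + DRDs + QsaQ) = 1)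
    (h : ‖(Δπ' + Δπ2) * G₀‖ < 1) :
    HasSum (fun n : ℕ => G₀ * ((Δπ' + Δπ2) * G₀) ^ n) (Ring.inverse ((Δ + DRDs + QsaQ) - (Δπ' + Δπ2))) :=
  eq3130_hasSum Δ DRDs QsaQ (Δπ' + Δπ2) G₀ h₁ h₂ h

/-- **`G₁` IS the propagator for `U₁`**: the sum (3.138) is a two-sided inverse of `G₁⁻¹ = Δ + DRD* + Q*aQ − (Δ′_π + Δ^{(2)}_π)`.
[cite: Balaban1985BackgroundPropagators, (3.136) p.422, (3.138) p.423] -/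
theorem eq3138_twoSided (Δ DRDs QsaQ Δπ' Δπ2 G₀ : R) (h₁ : (Δ + DRDs + QsaQ) * G₀ = 1) (h₂ : G₀ * (Δ + DRDs + QsaQ) = 1)
    (h : ‖(Δπ' + Δπ2) * G₀‖ < 1) :
    ((Δ + DRDs + QsaQ) - (Δπ' + Δπ2)) * gNew G₀ (Δπ' + Δπ2) = 1 ∧ gNew G₀ (Δπ' + Δπ2) * ((Δ + DRDs + QsaQ) - (Δπ' + Δπ2)) = 1 :=
  eq3130_twoSided Δ DRDs QsaQ (Δπ' + Δπ2) G₀ h₁ h₂ h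

/-- The resolvent form of (3.138): `G₁ = G₀ + G₀(Δ′_π + Δ^{(2)}_π)G₁`. [cite: Balaban1985BackgroundPropagators, (3.138) p.423] -/
theorem eq3138_fixedPoint (Δ DRDs QsaQ Δπ' Δπ2 G₀ : R) (h₁ : (Δ + DRDs + QsaQ) * G₀ = 1) (h₂ : G₀ * (Δ + DRDs + QsaQ) = 1)
    (h : ‖(Δπ' + Δπ2) * G₀‖ < 1) :
    gNew G₀ (Δπ' + Δπ2) = G₀ + G₀ * (Δπ' + Δπ2) * gNew G₀ (Δπ' + Δπ2) :=
  eq3130_fixedPoint Δ DRDs QsaQ (Δπ' + Δπ2) G₀ h₁ h₂ h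

end Neumann3138

end Literature.MathematicalPhysics.QuantumFieldTheory.Balaban1983to89.B9Eq3130Neumann

end
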